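import Summits.QuantumAdvantage.QuantumAdvantage.Theses.DWalkThree
import Summits.QuantumAdvantage.AdviceFreeQNC0.BShotFinal
import Summits.QuantumAdvantage.AdviceFreeQNC0.DWalkNormalForm
import HarnessLib

/-!
# Route DWalkThree, crux `RingBShot3` (stmt-QuantumAdvantage-22486): THEOREM A, the B-shot law — PROVED

The ring-language crux follows from the landed normal-form theorem
`Summit.QuantumAdvantage.AdviceFreeQNC0.DWalk.bShotDWB3 : BShotDWB3` (`AdviceFreeQNC0/BShotFinal.lean`, cell qa-qnc0,
ROUND-15 §3: window removal + Kilian gauge transport + structured law + Smolensky) by the dictionary of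
`AdviceFreeQNC0/DWalkNormalForm.lean` (`normalFormPlan3`): bells `w_k := [[P_k x = 1] ⊕ tGuess x k]` (degree
`≤ 2(log₂n)^c + 2 ≤ (log₂n)^{c+1}` for `n ≥ 16`), the trace form of the ring relation on the odd class
(`traceForm`, `dk3_ne_one_iff`), and `#{deviations from tGuess} = #{ringing bells}`.

* `dWalkThree_ringBShot3 : RingBShot3`.

WHAT THIS IS NOT: the dense residual `RingDenseResidualLt3` / `RingDenseResidual3` and `R0` `RingFixedBellsSharp3` stay OPEN;
rung F-Q2-odd3 (`p = 3`) only; separation NOT moved.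
-/

set_option linter.dupNamespace false

namespace Summit.QuantumAdvantage.QuantumAdvantage.Theorems

open Classical
open Finset
open Summit.QuantumAdvantage.AdviceFreeQNC0
open Literature.Computability.QuantumComplexity Literature.Computability.QuantumComplexity.RingHLF
open Literature.Computability.MetaComplexity Literature.Computability.MetaComplexity.Smolensky

/-- Degree bookkeeping: `2·(log₂ N)^c + 2 ≤ (log₂ N)^{c+1}` once `N ≥ 16`. -/
theorem dWalkThree_deg_bookkeeping {N : ℕ} (hN : 16 ≤ N) (c : ℕ) :
    2 * (Nat.log 2 N) ^ c + 2 ≤ (Nat.log 2 N) ^ (c + 1) := by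
  have hlog : 4 ≤ Nat.log 2 N := Nat.le_log_of_pow_le (by norm_num) hN
  have hone : 1 ≤ (Nat.log 2 N) ^ c := Nat.one_le_pow _ _ (by omega)
  rw [pow_succ]
  nlinarith

/-- **Crux `RingBShot3` (THEOREM A, the B-shot two-thirds law) — PROVED.** -/
theorem dWalkThree_ringBShot3 : Summit.QuantumAdvantage.QuantumAdvantage.Theses.DWalkThree.RingBShot3 := by
  unfold Summit.QuantumAdvantage.QuantumAdvantage.Theses.DWalkThree.RingBShot3
  intro ε hε c
  obtain ⟨n₀, hn₀⟩ := DWalk.bShotDWB3 ε hε (c + 1)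
  refine ⟨max n₀ 16, fun N hN P hP hshot => ?_⟩
  have hn₀N : n₀ ≤ N := le_trans (le_max_left _ _) hN
  have h16 : 16 ≤ N := le_trans (le_max_right _ _) hN
  -- the bells
  set w : Fin N → CubeFn (ZMod 3) N := fun k => bellOf (P k) k with hw
  have hwdeg : ∀ k, w k ∈ lowDeg (ZMod 3) N ((Nat.log 2 N) ^ (c + 1)) := fun k =>
    lowDeg_mono (dWalkThree_deg_bookkeeping h16 c) (bellOf_mem_lowDeg (hP k) k)
  -- the B-shot hypothesis: deviations from the canonical guess = ringing bells
  have hshot' : ∀ x : Fin N → Bool, (univ.filter fun b : Fin N => x b = false).card % 2 = 1 →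
      (univ.filter fun k : Fin N => w k x = 1).card ^ 4 ≤ N := by
    intro x hodd
    have h := hshot x hodd
    -- the bell rings iff the answer bit deviates from the canonical guess
    have hbell : ∀ k : Fin N, w k x = 1 ↔ decide (P k x = 1) ≠ tGuess x k := fun k => by
      show bellOf (P k) k x = 1 ↔ _
      rw [bellOf_eq_one_iff]
      cases decide (P k x = 1) <;> cases tGuess x k <;> decide
    have heq : (univ.filter fun k : Fin N => w k x = 1) =
        univ.filter fun i : Fin N => decide (P i x = 1) ≠ tGuess x i := by
      ext k
      simp only [mem_filter, mem_univ, true_and, hbell]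
    rw [heq]
    convert h using 2
  have hcount := hn₀ N hn₀N w hwdeg hshot'
  -- identify the solved odd patterns with the winning odd patterns of the normal form
  have hset : (univ.filter fun x : Fin N → Bool => OddZeros x ∧ Rel x (fun i => decide (P i x = 1))) =
      univ.filter fun x : Fin N → Bool =>
        (univ.filter fun b : Fin N => x b = false).card % 2 = 1 ∧
          (univ.filter fun k : Fin N => w k x = 1 ∧ Dk3 x k.val ≠ 1).card % 2 = 1 := by
    ext x
    simp only [mem_filter, mem_univ, true_and]
    constructor
    · rintro ⟨hodd, hrel⟩
      refine ⟨hodd, ?_⟩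
      rw [traceForm (by omega) x hodd] at hrel
      have heq : (univ.filter fun k : Fin N => xor (decide (P k x = 1)) (tGuess x k) = true ∧
            (k.val + N + Wk x k.val + Wk x (N - 1)) % 3 ≠ 2) =
          univ.filter fun k : Fin N => w k x = 1 ∧ Dk3 x k.val ≠ 1 := by
        ext k
        simp only [mem_filter, mem_univ, true_and, hw, bellOf_eq_one_iff, dk3_ne_one_iff]
      rw [heq] at hrel
      exact hrel
    · rintro ⟨hodd, hwin⟩
      refine ⟨hodd, ?_⟩
      rw [traceForm (by omega) x hodd]
      have heq : (univ.filter fun k : Fin N => xor (decide (P k x = 1)) (tGuess x k) = true ∧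
            (k.val + N + Wk x k.val + Wk x (N - 1)) % 3 ≠ 2) =
          univ.filter fun k : Fin N => w k x = 1 ∧ Dk3 x k.val ≠ 1 := by
        ext k
        simp only [mem_filter, mem_univ, true_and, hw, bellOf_eq_one_iff, dk3_ne_one_iff]
      rw [heq]
      exact hwin
  have hset' : ((univ.filter fun x : Fin N → Bool => OddZeros x ∧ Rel x (fun i => decide (P i x = 1))).card : ℝ) =
      ((univ.filter fun x : Fin N → Bool =>
        (univ.filter fun b : Fin N => x b = false).card % 2 = 1 ∧
          (univ.filter fun k : Fin N => w k x = 1 ∧ Dk3 x k.val ≠ 1).card % 2 = 1).card : ℝ) := by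
    rw [hset]
  have hpow : (2 : ℝ) ^ N = 2 * (2 : ℝ) ^ (N - 1) := by
    rw [← pow_succ']; congr 1; omega
  rw [hpow] at hcount
  have hT : (0 : ℝ) ≤ ε * (2 : ℝ) ^ (N - 1) := by positivity
  have hfin : ((univ.filter fun x : Fin N → Bool => OddZeros x ∧ Rel x (fun i => decide (P i x = 1))).card : ℝ) ≤
      (2 / 3 + ε) * (2 : ℝ) ^ (N - 1) := by
    rw [hset']; linarith
  convert hfin using 2

end Summit.QuantumAdvantage.QuantumAdvantage.Theorems
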